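import Summits.ResolutionOfSingularities.ResolutionOfSingularities.Theorems.HilbertSamuelEliminationSigmaMaxModificationsCorridor3WLadderSegmentsBirthZero
import Summits.ResolutionOfSingularities.ResolutionOfSingularities.Theorems.HilbertSamuelEliminationSigmaMaxModificationsCorridor3WLadderSegmentsHEmpStrongPlus
import Summits.ResolutionOfSingularities.ResolutionOfSingularities.Theorems.HilbertSamuelEliminationSigmaMaxModificationsCorridor3WLadderSegmentsCentreOne
import HarnessLib

/-!
# [OURS · L1 W4.2] RECOGNITION ASSEMBLY, STEP A: (Dich⁺)/(RegN) at EVERY interior stage of a unit, hence (H-emp)U, hence the unit tower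
# `unitTowerU` with clauses (ii)′, (iii) of Def. 6.38 — modulo the printed facts and (F1)
# (crux `SigmaMaxModifications` stmt-ResolutionOfSingularities-18506; conjunct `SigmaMaxModificationsCorridor3` stmt-…-19249; line `w_ladder`)

Stub worker res-L1-w42-stub-1 (gen 4). Helper file `--supports stmt-ResolutionOfSingularities-19249 --as helper`; kernel only, no new definition.
WIRING: the strong invariant `Seg.invariant_strongPlus` (births ⟹ everything) with its birth hypothesis DISCHARGED by the first birth
`Seg.dichPlus_regN_birth_zero` (over the point `x_b`: `N_1 ⊆ ℙ(Dir)`) and the interior births `Seg.dichPlus_regN_birth` (stub-2's one-step geometry on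
the partially compressed tower `unitTowerL b L`), with the index bookkeeping `n = relIdx b L`, `relIdxL b L (L+1) = relIdx b L + 1`.

* `Seg.invariant_of_printedFacts` — the invariant data at every `n < relIdxU b (relLen b)`;
* `Seg.dich_regN_of_printedFacts` — (Dich)/(RegN) at every `0 < n < relIdxU b (relLen b)`;
* **`Seg.hEmpU_of_printedFacts`** — (H-emp)U;  `Seg.unitTowerU_C_one_of_printedFacts` ((ii)′), `Seg.unitTowerU_C_eq_nearLocus_of_printedFacts` ((iii)).

Printed facts as binders: `Thm314_point_locus`, `CossartJannsenSaito2020_thm_3_14`, `Thm314_nearFibre_subsingleton`, `CossartJannsenSaito2020_thm_3_6`,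
`CossartJannsenSaito2020_thm_3_10_4`; base data: `b` blown up and `Iso`, (F1) `CharHypothesis` at `x_b`, `e_{x_b} = 2`, `ē_{x_b} ≤ 2`.

OURS bookkeeping; NOT a statement of the manuscript [Hironaka2017] nor of [CossartJannsenSaito2020]. AI-written; AI review is weaker than expert review.

References: V. Cossart, U. Jannsen, S. Saito, LNM 2270 (2020), Rem. 6.29, Lemma 6.33, Def. 6.34, Def. 6.38, p. 150–160 [CossartJannsenSaito2020].
-/

noncomputable section

set_option linter.dupNamespace false -- namespace `…Corridor3.Moving` re-enters `…Corridor3` (module convention of the Moving files)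

open CategoryTheory AlgebraicGeometry TopologicalSpace Topology IsLocalRing
open Literature.AlgebraicGeometry.Resolution Literature.RingTheory.HilbertSamuel
open Literature.AlgebraicGeometry.CossartJannsenSaito2020
open Summit.ResolutionOfSingularities.ResolutionOfSingularities.Theorems.CampaignW42
open Summit.ResolutionOfSingularities.ResolutionOfSingularities.Theorems.SigmaMaxModificationsCorridor3.Helpers

namespace Summit.ResolutionOfSingularities.ResolutionOfSingularities.Theorems.SigmaMaxModificationsCorridor3.Moving.Seg

variable {R : ∀ S : Scheme.{0}, CentreSeq S → Prop} {N : ℕ} {ν : ℕ → ℕ} {k : Type} [Field k]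
  {c : ℕ → MarkedStage.{0}} (hc : ∀ n, CanonicalNearStep R N ν (c n) (c (n + 1))) (hRf : OracleFunctional R) (hRa : OracleAdmissible R)
  (hν : ν ≠ iterPSum N Phi) (h0 : Helpers.CycleInv k N ν (c 0)) (hgen : ∀ n, ∃ m, n ≤ m ∧ (c m).IsBlownUp R N ν)
  (hBG : ∀ n, ∃ m, n ≤ m ∧ (c m).IsBlownUp R N ν ∧ Iso N (c m))
  {p : ℕ} {X : Scheme.{0}} [IsLocallyNoetherian X] {x : X} (hX : IsMaximalOrigin p N ν X x)
  (hreach : Reaches R N ν (MarkedStage.init X x) (c 0))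

include hRf hX hreach in
/-- **THE INVARIANT FROM THE PRINTED FACTS**: at every stage `n < relIdxU b (relLen b)` of the unit based at a blown-up `Iso` stage `b` (in the (F1) range,
`e = 2`, `ē ≤ 2`): «genuine ⇒ `N_n ⊆ C_{b+n}`», «waiting ⇒ `C_{b+n} ∩ N_n = ∅`», (Dich⁺_n), (RegN_n), and for `0 < n` one label + replay avoidance.
[cite: CossartJannsenSaito2020, Rem. 6.29 (1), Lemma 6.33, Def. 6.34, Def. 6.38] -/
theorem invariant_of_printedFacts (h314pt : Thm314_point_locus.{0}) (h314 : CossartJannsenSaito2020_thm_3_14.{0})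
    (h314f : Thm314_nearFibre_subsingleton.{0}) (h36 : CossartJannsenSaito2020_thm_3_6.{0}) (h3104 : CossartJannsenSaito2020_thm_3_10_4.{0})
    (b : ℕ) (hb : (c b).IsBlownUp R N ν) (hiso : Iso N (c b)) (hchar : CharHypothesis (c b).W (c b).pt) (he : dirDim (c b) = 2)
    (hē : (c b).geomDirDim ≤ 2) :
    ∀ n, n < Seg.relIdxU hgen hBG b (Seg.relLen hgen hBG b) →
      (((c (b + n)).IsBlownUp R N ν → (upTower hc hRa hν h0 b).nearLocus N (c b).pt n ⊆ (upTower hc hRa hν h0 b).C n) ∧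
        (¬ (c (b + n)).IsBlownUp R N ν → (upTower hc hRa hν h0 b).C n ∩ (upTower hc hRa hν h0 b).nearLocus N (c b).pt n = ∅) ∧
        ((((upTower hc hRa hν h0 b).nearLocus N (c b).pt n).Infinite ∧ IsIrreducible ((upTower hc hRa hν h0 b).nearLocus N (c b).pt n) ∧
          ∀ y ∈ (upTower hc hRa hν h0 b).nearLocus N (c b).pt n, ¬ IsGenericPoint y ((upTower hc hRa hν h0 b).nearLocus N (c b).pt n) →
            IsClosed ({y} : Set (c (b + n)).W)) ∨
          (((upTower hc hRa hν h0 b).nearLocus N (c b).pt n).Finite ∧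
            ∀ y ∈ (upTower hc hRa hν h0 b).nearLocus N (c b).pt n, IsClosed ({y} : Set (c (b + n)).W))) ∧
        (((upTower hc hRa hν h0 b).nearLocus N (c b).pt n).Infinite →
          ∀ h : IsClosed ((upTower hc hRa hν h0 b).nearLocus N (c b).pt n),
            Scheme.IsRegular (Scheme.IdealSheafData.vanishingIdeal ⟨(upTower hc hRa hν h0 b).nearLocus N (c b).pt n, h⟩).subscheme)) ∧
      (0 < n →
        (∀ Z₁ ∈ componentsIn (Scheme.hsStratum (c (b + n)).W N ν), ∀ Z₂ ∈ componentsIn (Scheme.hsStratum (c (b + n)).W N ν),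
          Z₁ ⊆ (upTower hc hRa hν h0 b).nearLocus N (c b).pt n → Z₂ ⊆ (upTower hc hRa hν h0 b).nearLocus N (c b).pt n →
            (c (b + n)).L.label Z₁ = (c (b + n)).L.label Z₂) ∧
        ∀ Q, (c (b + n)).P = some Q → Q.rest.CentresOver (Q.hom.base ⁻¹' ((upTower hc hRa hν h0 b).nearLocus N (c b).pt n)ᶜ)) := by
  obtain ⟨k', _, _, hg⟩ := hX.exists_stateGood_of_reaches hRa hν (reaches_chain hreach hc b)
  have hU := stratumIsolated_of_iso hg hiso
  refine invariant_strongPlus hc hRf hRa hν h0 hX hreach b hb hiso (Seg.relIdxU hgen hBG b (Seg.relLen hgen hBG b)) ?_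
  intro n hnM hbn hdata
  obtain ⟨L, hL⟩ := Seg.exists_relIdx_eq hgen b hbn
  subst hL
  have hmono := (BlowupTower.cidx_strictMono 0 (Seg.relGap hgen b)).monotone
  have hLlt : L < Seg.relLen hgen hBG b := by
    refine lt_of_not_ge fun hge => ?_
    have h1 : Seg.relIdx hgen b (Seg.relLen hgen hBG b) ≤ Seg.relIdx hgen b L := hmono hge
    rw [Seg.relIdxU_eq_of_le hgen hBG b le_rfl] at hnM
    omega
  rw [show Seg.relIdx hgen b L + 1 = Seg.relIdxL hgen b L (L + 1) from (Seg.relIdxL_succ_self hgen b L).symm]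
  rcases Nat.eq_zero_or_pos L with hL0 | hLpos
  · subst hL0
    exact dichPlus_regN_birth_zero hc hRf hRa hν h0 hgen hX hreach h314pt b hb hiso hchar he
  · -- hypotheses of the interior birth, read off the invariant data at the stages `≤ relIdx b L`
    have hempL : ∀ n, n < Seg.relIdx hgen b L → ¬ (c (b + n)).IsBlownUp R N ν → (locTower hc hRa hν h0 b).C n = ∅ := fun n hn hw =>
      (locTower_C_eq_empty_iff hc hRa hν h0 hX hreach b hU n).mpr ((hdata n hn.le).2.1 hw)
    have hNC : ∀ i, i ≤ L → (upTower hc hRa hν h0 b).nearLocus N (c b).pt (Seg.relIdxL hgen b L i) ⊆ (upTower hc hRa hν h0 b).C (Seg.relIdxL hgen b L i) := by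
      intro i hi
      rw [Seg.relIdxL_eq_of_le hgen b L hi]
      exact (hdata _ (hmono hi)).1 (Seg.B_add_relIdx hgen hb i)
    have hdL := hdata (Seg.relIdx hgen b L) le_rfl
    have hnotG : ¬ Iso N (c (b + Seg.relIdx hgen b L)) := Seg.not_G_add_relIdx_of_lt_relLen hgen hBG b hLpos hLlt
    have hD : (((upTower hc hRa hν h0 b).nearLocus N (c b).pt (Seg.relIdx hgen b L)).Infinite ∧
          IsIrreducible ((upTower hc hRa hν h0 b).nearLocus N (c b).pt (Seg.relIdx hgen b L))) ∨
        (((upTower hc hRa hν h0 b).nearLocus N (c b).pt (Seg.relIdx hgen b L)).Finite ∧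
          ∀ y ∈ (upTower hc hRa hν h0 b).nearLocus N (c b).pt (Seg.relIdx hgen b L), IsClosed ({y} : Set (c (b + Seg.relIdx hgen b L)).W)) :=
      hdL.2.2.1.imp (fun h => ⟨h.1, h.2.1⟩) id
    obtain ⟨hinf, hirr⟩ := infinite_irreducible_nearLocus_of_not_iso hc hRa hν h0 hX hreach b hU _ hnotG hD
    have hpts : ∀ y ∈ (upTower hc hRa hν h0 b).nearLocus N (c b).pt (Seg.relIdx hgen b L),
        ¬ IsGenericPoint y ((upTower hc hRa hν h0 b).nearLocus N (c b).pt (Seg.relIdx hgen b L)) →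
          IsClosed ({y} : Set (c (b + Seg.relIdx hgen b L)).W) := by
      rcases hdL.2.2.1 with h | h
      · exact h.2.2
      · exact absurd h.1 hinf
    have hinf' : ((upTower hc hRa hν h0 b).nearLocus N (c b).pt (Seg.relIdxL hgen b L L)).Infinite := by
      rw [Seg.relIdxL_eq_of_le hgen b L le_rfl]; exact hinf
    have hirr' : IsIrreducible ((upTower hc hRa hν h0 b).nearLocus N (c b).pt (Seg.relIdxL hgen b L L)) := by
      rw [Seg.relIdxL_eq_of_le hgen b L le_rfl]; exact hirr
    have hpts' : ∀ y ∈ (upTower hc hRa hν h0 b).nearLocus N (c b).pt (Seg.relIdxL hgen b L L),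
        ¬ IsGenericPoint y ((upTower hc hRa hν h0 b).nearLocus N (c b).pt (Seg.relIdxL hgen b L L)) →
          IsClosed ({y} : Set (c (b + Seg.relIdxL hgen b L L)).W) := by
      rw [Seg.relIdxL_eq_of_le hgen b L le_rfl]; exact hpts
    exact dichPlus_regN_birth hc hRa hν h0 hgen hX hreach h314pt h314 h314f h36 h3104 b hU hchar hē L hempL hNC hinf' hirr' hpts'

include hRf hX hreach in
/-- **(Dich)/(RegN) AT EVERY INTERIOR STAGE OF THE UNIT, FROM THE PRINTED FACTS.** [cite: CossartJannsenSaito2020, Lemma 6.33, Def. 6.34] -/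
theorem dich_regN_of_printedFacts (h314pt : Thm314_point_locus.{0}) (h314 : CossartJannsenSaito2020_thm_3_14.{0})
    (h314f : Thm314_nearFibre_subsingleton.{0}) (h36 : CossartJannsenSaito2020_thm_3_6.{0}) (h3104 : CossartJannsenSaito2020_thm_3_10_4.{0})
    (b : ℕ) (hb : (c b).IsBlownUp R N ν) (hiso : Iso N (c b)) (hchar : CharHypothesis (c b).W (c b).pt) (he : dirDim (c b) = 2)
    (hē : (c b).geomDirDim ≤ 2) :
    (∀ n, 0 < n → n < Seg.relIdxU hgen hBG b (Seg.relLen hgen hBG b) →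
      (((upTower hc hRa hν h0 b).nearLocus N (c b).pt n).Infinite ∧ IsIrreducible ((upTower hc hRa hν h0 b).nearLocus N (c b).pt n)) ∨
        (((upTower hc hRa hν h0 b).nearLocus N (c b).pt n).Finite ∧
          ∀ y ∈ (upTower hc hRa hν h0 b).nearLocus N (c b).pt n, IsClosed ({y} : Set (c (b + n)).W))) ∧
    (∀ n, 0 < n → n < Seg.relIdxU hgen hBG b (Seg.relLen hgen hBG b) →
      ((upTower hc hRa hν h0 b).nearLocus N (c b).pt n).Infinite →
        ∀ h : IsClosed ((upTower hc hRa hν h0 b).nearLocus N (c b).pt n),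
          Scheme.IsRegular (Scheme.IdealSheafData.vanishingIdeal ⟨(upTower hc hRa hν h0 b).nearLocus N (c b).pt n, h⟩).subscheme) := by
  have hI := invariant_of_printedFacts hc hRf hRa hν h0 hgen hBG hX hreach h314pt h314 h314f h36 h3104 b hb hiso hchar he hē
  exact ⟨fun n _ hn => (hI n hn).1.2.2.1.imp (fun h => ⟨h.1, h.2.1⟩) id, fun n _ hn => (hI n hn).1.2.2.2⟩

include hRf hX hreach in
/-- **(H-emp)U FROM THE PRINTED FACTS**: in a unit based at a blown-up `Iso` stage (in the (F1) range, `e = 2`, `ē ≤ 2`), every waiting stage strictly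
inside the unit has empty localised centre. [cite: CossartJannsenSaito2020, Rem. 6.29 (1), Def. 6.38] -/
theorem hEmpU_of_printedFacts (h314pt : Thm314_point_locus.{0}) (h314 : CossartJannsenSaito2020_thm_3_14.{0})
    (h314f : Thm314_nearFibre_subsingleton.{0}) (h36 : CossartJannsenSaito2020_thm_3_6.{0}) (h3104 : CossartJannsenSaito2020_thm_3_10_4.{0})
    (b : ℕ) (hb : (c b).IsBlownUp R N ν) (hiso : Iso N (c b)) (hchar : CharHypothesis (c b).W (c b).pt) (he : dirDim (c b) = 2)
    (hē : (c b).geomDirDim ≤ 2) : HEmpU hc hRa hν h0 hgen hBG b := by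
  obtain ⟨k', _, _, hg⟩ := hX.exists_stateGood_of_reaches hRa hν (reaches_chain hreach hc b)
  have hU := stratumIsolated_of_iso hg hiso
  have hI := invariant_of_printedFacts hc hRf hRa hν h0 hgen hBG hX hreach h314pt h314 h314f h36 h3104 b hb hiso hchar he hē
  intro n hn hw
  exact (locTower_C_eq_empty_iff hc hRa hν h0 hX hreach b hU n).mpr ((hI n hn).1.2.1 hw)

include hRf hX hreach in
/-- **Def. 6.38 (ii)′ FROM THE PRINTED FACTS**: `C_1 = ℙ(Dir(𝒪_{x_b}))` on the unit tower, when the unit has `≥ 2` blown-up stages ((2,2) at the `Iso`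
stages supplies `e = 2`, `ē ≤ 2` at the base). [cite: CossartJannsenSaito2020, Def. 6.38 (ii), Thm. 3.14] -/
theorem unitTowerU_C_one_of_printedFacts (h314pt : Thm314_point_locus.{0}) (h314 : CossartJannsenSaito2020_thm_3_14.{0})
    (h314f : Thm314_nearFibre_subsingleton.{0}) (h36 : CossartJannsenSaito2020_thm_3_6.{0}) (h3104 : CossartJannsenSaito2020_thm_3_10_4.{0})
    (b : ℕ) (hb : (c b).IsBlownUp R N ν) (hiso : Iso N (c b)) (hchar : CharHypothesis (c b).W (c b).pt)
    (h22 : ∀ n, Iso N (c n) → dirDim (c n) = 2 ∧ (c n).geomDirDim = 2) (h2 : 2 ≤ unitLen hgen hBG b) :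
    (unitTowerU hc hRa hν h0 hgen hBG b (hEmpU_of_printedFacts hc hRf hRa hν h0 hgen hBG hX hreach h314pt h314 h314f h36 h3104 b hb hiso hchar
        (h22 b hiso).1 (h22 b hiso).2.le)).C 1 =
      (unitTowerU hc hRa hν h0 hgen hBG b (hEmpU_of_printedFacts hc hRf hRa hν h0 hgen hBG hX hreach h314pt h314 h314f h36 h3104 b hb hiso hchar
        (h22 b hiso).1 (h22 b hiso).2.le)).projDir (basePt hc hRa hν h0 b) := by
  have hDR := dich_regN_of_printedFacts hc hRf hRa hν h0 hgen hBG hX hreach h314pt h314 h314f h36 h3104 b hb hiso hchar (h22 b hiso).1 (h22 b hiso).2.le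
  exact unitTowerU_C_one_eq_projDir hc hRf hRa hν h0 hgen hBG hX hreach h314pt b hb hiso hchar h22 hDR.1 hDR.2 _ h2

include hRf hX hreach in
/-- **Def. 6.38 (iii) FROM THE PRINTED FACTS**: at every kept stage `q < unitLen` of the unit tower the centre IS the near locus of the base point.
[cite: CossartJannsenSaito2020, Def. 6.38 (iii), Rem. 6.29 (1)] -/
theorem unitTowerU_C_eq_nearLocus_of_printedFacts (h314pt : Thm314_point_locus.{0}) (h314 : CossartJannsenSaito2020_thm_3_14.{0})
    (h314f : Thm314_nearFibre_subsingleton.{0}) (h36 : CossartJannsenSaito2020_thm_3_6.{0}) (h3104 : CossartJannsenSaito2020_thm_3_10_4.{0})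
    (b : ℕ) (hb : (c b).IsBlownUp R N ν) (hiso : Iso N (c b)) (hchar : CharHypothesis (c b).W (c b).pt) (he : dirDim (c b) = 2)
    (hē : (c b).geomDirDim ≤ 2) {q : ℕ} (hq : q < unitLen hgen hBG b) :
    (unitTowerU hc hRa hν h0 hgen hBG b (hEmpU_of_printedFacts hc hRf hRa hν h0 hgen hBG hX hreach h314pt h314 h314f h36 h3104 b hb hiso hchar he hē)).C q =
      (unitTowerU hc hRa hν h0 hgen hBG b (hEmpU_of_printedFacts hc hRf hRa hν h0 hgen hBG hX hreach h314pt h314 h314f h36 h3104 b hb hiso hchar he hē)).nearLocus N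
        (basePt hc hRa hν h0 b) q :=
  (unitTowerU_C_eq_nearLocus hc hRf hRa hν h0 hgen hBG hX hreach b hb hiso
    (dich_regN_of_printedFacts hc hRf hRa hν h0 hgen hBG hX hreach h314pt h314 h314f h36 h3104 b hb hiso hchar he hē).1
    (dich_regN_of_printedFacts hc hRf hRa hν h0 hgen hBG hX hreach h314pt h314 h314f h36 h3104 b hb hiso hchar he hē).2 _ hq)

end Summit.ResolutionOfSingularities.ResolutionOfSingularities.Theorems.SigmaMaxModificationsCorridor3.Moving.Seg

end
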